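import Summits.BirchSwinnertonDyer.BirchSwinnertonDyer.Theses.UniversalToricDescent
import Summits.BirchSwinnertonDyer.BirchSwinnertonDyer.Theorems.UniversalToricDescentToricKernelAtThreeDegreeOnlyTwinOfPrint
import HarnessLib
-- buildfix (bf3-g30) G30-44: comment-only touch to re-dispatch the lane build (dead-lettered rc 76 att 7 (15:53–16:15) behind Theorems.UniversalToricDescentToricKernelAtThreeApZeroOddDefectPTTROfPrint, which was red between the route's 15:07/16:10 closes re-keys and my re-glues (G30-30/G30-36, hub olean 16:18); file farm rc 0); declarations byte-identical

/-!
# Route `UniversalToricDescent` — MONOTONICITY BY NAME after act DEG: ♭B′ 27401 ⟹ ♭B′° 22539 and ♭C₀_T 27173 ⟹ ♭C₀° 22540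

LEAD bsd-wall-utd-p2 g15 (line `membertower` on ♭B′ `TwinWanFrameAtThreeMultTresT` 27401 / ♭B′° `TwinDegreeFrameAtThreeMultTresT`
22539), 2026-08-28; `--supports stmt-BirchSwinnertonDyer-22539 --as helper` (the ♭C₀ twin serves 22540 identically). The pen
(bsd-wall-pss3x g5, rev 69) kept ♭B′ 27401 / ♭C₀_T 27173 OPEN beside the new degree-only cruxes and could not file the two
monotonicity implications as items (route.items-cap 15); it asked the LEAD to land them BY NAME so that every line registered on
27401 / 27173 (membertower v12, threeframes_apzero) demonstrably closes the ° items. Both are one-line wrappers of the width seat's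
δ-unfolded theorems `twinDegreeFrameMultTresT_of_wanFrame` / `twinDegreeFrameGoodSSApZeroT_of_wanFrame` (p640116 §4, utd-p2-w2 g6),
which cancel `3^k` against `μ(L) = 0` (`dvd_of_mem_of_C_pow_mul_mem_span`) and compare first unit coefficients
(`firstUnitCoeff_le_of_dvd`). Pen certificate: `utdE/SketchE.lean` 1f1e9420bd7c4291 (§Closers, same terms).

HONEST FRAMING: implications between OPEN route items; nothing is closed by this file; the research content of the B′/C₀ columns
(K1-at-3 stmt-…-27934; the a₃ = 0 Beilinson–Flach bound) is untouched; BSD is proved for no curve. Reference for the degree road: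
[GreenbergVatsal2000] Thm. (1.4) (λ/μ bookkeeping of characteristic power series).
-/

set_option linter.dupNamespace false
set_option autoImplicit false

namespace Summit.BirchSwinnertonDyer.BirchSwinnertonDyer.Theorems.UniversalToricDescentTwinDegreeFrameOfWanFrame

open Summit.BirchSwinnertonDyer.BirchSwinnertonDyer.Theses.UniversalToricDescent
  Summit.BirchSwinnertonDyer.BirchSwinnertonDyer.Theorems.UniversalToricDescentKernelDegreeOnlyTwinOfPrint

/-- **♭B′ ⟹ ♭B′° BY NAME**: the rational Wan frame for très-ramifié multiplicative twins (`TwinWanFrameAtThreeMultTresT`, item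
27401) implies the degree-only frame (`TwinDegreeFrameAtThreeMultTresT`, item 22539): same binders, same ∃-frame, and under torsion
`∃ k, C(3^k)·G ∈ (L)` for all `G ∈ Ch·R₀⟦T⟧` forces `m ≤ n` for every unit-profile generator index `n` of `Ch·R₀⟦T⟧` and profile
index `m` of `L` (p640116 §4 `twinDegreeFrameMultTresT_of_wanFrame`). [cite: GreenbergVatsal2000, Thm. (1.4)] -/
theorem twinDegreeFrameAtThreeMultTresT_of_wanFrame (h : TwinWanFrameAtThreeMultTresT) :
    TwinDegreeFrameAtThreeMultTresT :=
  twinDegreeFrameMultTresT_of_wanFrame h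

/-- **♭C₀_T ⟹ ♭C₀° BY NAME**: the rational Wan frame for good-supersingular `a₃ = 0` twins (`TwinWanFrameAtThreeGoodSSApZeroT`,
item 27173) implies the degree-only frame (`TwinDegreeFrameAtThreeGoodSSApZeroT`, item 22540) (p640116 §4
`twinDegreeFrameGoodSSApZeroT_of_wanFrame`). [cite: GreenbergVatsal2000, Thm. (1.4)] -/
theorem twinDegreeFrameAtThreeGoodSSApZeroT_of_wanFrame (h : TwinWanFrameAtThreeGoodSSApZeroT) :
    TwinDegreeFrameAtThreeGoodSSApZeroT :=
  twinDegreeFrameGoodSSApZeroT_of_wanFrame h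

/-- The act-DEG `closes` binders `hB`, `hC` from the act-R items: ♭B′ ∧ ♭C₀_T ⟹ ♭B′° ∧ ♭C₀° (so the aside package P_R 27405
implies the degree package the kernel⁵ item 22543 consumes). [cite: GreenbergVatsal2000, Thm. (1.4)] -/
theorem twinDegreeFrames_of_wanFrames (hB' : TwinWanFrameAtThreeMultTresT) (hC' : TwinWanFrameAtThreeGoodSSApZeroT) :
    TwinDegreeFrameAtThreeMultTresT ∧ TwinDegreeFrameAtThreeGoodSSApZeroT :=
  ⟨twinDegreeFrameAtThreeMultTresT_of_wanFrame hB', twinDegreeFrameAtThreeGoodSSApZeroT_of_wanFrame hC'⟩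

end Summit.BirchSwinnertonDyer.BirchSwinnertonDyer.Theorems.UniversalToricDescentTwinDegreeFrameOfWanFrame
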